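import Summits.QuantumFields.YangMills.Theorems.LangevinControlUVFemtoCurvatureTwoPointCOneLinkLaplace
import Literature.MathematicalPhysics.QuantumLattice.YangMillsClassical
import HarnessLib

/-!
# Volume of a conjugation-orbit tube in a product of compact matrix groups
# (helper toward the crux `TwistExponentGap.RigidTwistCeiling` ⟨stmt-QuantumFields-24054⟩)

GEOMETRIC bookkeeping for the Morse–Bott ceiling of route `TwistExponentGap` (planner ym-idea-4 g13; its BC3 skeleton's geometric
stub `stub_sublevel_rigid` bounds the Haar volume of the sublevel sets of the twisted Wilson action by `C t^{(3S⁴−1)D/2+δ}`): under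
rigidity the twisted-flat lattice connections form FINITELY MANY ORBITS of the residual global gauge group acting by simultaneous
conjugation on the `F = 3S⁴+1` gauge-fixed links, and a Morse–Bott inequality puts the sublevel set `{S_z ≤ t}` inside tubes of radius
`≍ √t` around those orbits.  This file supplies the volume of such a tube, for every compact group `G` with a faithful unitary
representation `ρ` (`D = dimE ρ`), every finite index type `ι` and every centre configuration `W : ι → G`:

  `Haar^ι { V | ∃ g, ∀ e, ‖ρ(V e) − ρ(g W_e g⁻¹)‖ ≤ r } ≤ C · r^{D·(|ι| − 1)}`   for `0 < r ≤ 1`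

(`orbitTube_measureReal_le`; `C` independent of `W`).  Mechanism: a maximal `r`-separated finite set `T ⊂ G` is an `r`-net with
`|T| ≤ 1/Haar(B_{r/2}) ≤ 2^D/(c₁ r^D)` by disjointness of the `r/2`-balls and the tree's small-ball floor `exists_haar_gball_ge`;
conjugation is `2`-Lipschitz in the Hilbert–Schmidt norm, so the tube lies in `|T|` product boxes of radius `3r`, each of mass
`Haar(B_{3r})^{|ι|} ≤ (c₂ (3r)^D)^{|ι|}` by the tree's small-ball ceiling `exists_haar_gball_le`; one factor `r^D` cancels against `|T|`.
HONEST FRAMING: the Morse–Bott inequality itself (the content of ⟨24054⟩) is NOT proved here; nothing here bears on a summit statement or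
the Yang–Mills mass gap.  THEOREMS ONLY, standard axioms.
-/

set_option autoImplicit false

noncomputable section

open scoped Matrix.Norms.Frobenius ENNReal BigOperators
open MeasureTheory
open Literature.MathematicalPhysics.QuantumFieldTheory
open Summit.QuantumFields.YangMills.Theorems.FreeEnergyLogCoefficient (dimE exists_haar_gball_ge measurableSet_gball norm_rho_sub_rho
  setOf_norm_sub_le_eq_preimage haar_setOf_norm_sub_le)
open Summit.QuantumFields.YangMills.Theorems.FemtoCurvatureTwoPointC (exists_haar_gball_le)

namespace Summit.QuantumFields.YangMills.Theorems.TwistExponentGap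

variable {G : Type*} [Group G] [TopologicalSpace G] [IsTopologicalGroup G] [CompactSpace G]
  [MeasurableSpace G] [BorelSpace G] {N : ℕ} (ρ : G →* Matrix (Fin N) (Fin N) ℂ)

/-! ## §1 Conjugation is `2`-Lipschitz (balls around a point: the tree's `setOf_norm_sub_le_eq_preimage`, `haar_setOf_norm_sub_le`) -/

omit [TopologicalSpace G] [IsTopologicalGroup G] [CompactSpace G] [MeasurableSpace G] [BorelSpace G] in
/-- **Conjugation is `2`-Lipschitz** in the Hilbert–Schmidt norm of a unitary representation:
`‖ρ(g W g⁻¹) − ρ(t W t⁻¹)‖ ≤ 2‖ρ g − ρ t‖`. -/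
theorem norm_conj_sub_conj_le (hU : ∀ g, ρ g ∈ Matrix.unitaryGroup (Fin N) ℂ) (g t W : G) :
    ‖ρ (g * W * g⁻¹) - ρ (t * W * t⁻¹)‖ ≤ 2 * ‖ρ g - ρ t‖ := by
  have e : ρ (g * W * g⁻¹) - ρ (t * W * t⁻¹) =
      (ρ g - ρ t) * (ρ W * ρ g⁻¹) + ρ t * ρ W * (ρ g⁻¹ - ρ t⁻¹) := by
    simp only [map_mul]; noncomm_ring
  have h1 : ‖(ρ g - ρ t) * (ρ W * ρ g⁻¹)‖ = ‖ρ g - ρ t‖ := by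
    rw [← map_mul]
    exact Matrix.frobenius_norm_mul_unitaryGroup (ρ g - ρ t) ⟨ρ (W * g⁻¹), hU _⟩
  have h2 : ‖ρ t * ρ W * (ρ g⁻¹ - ρ t⁻¹)‖ = ‖ρ g⁻¹ - ρ t⁻¹‖ := by
    rw [← map_mul]
    exact Matrix.frobenius_norm_unitaryGroup_mul ⟨ρ (t * W), hU _⟩ (ρ g⁻¹ - ρ t⁻¹)
  -- `‖ρ g⁻¹ − ρ t⁻¹‖ = ‖ρ g − ρ t‖`: for a unitary representation `ρ x⁻¹ = (ρ x)ᴴ`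
  have hstar : ∀ x : G, ρ x⁻¹ = (ρ x).conjTranspose := fun x => by
    have h1 : ρ x⁻¹ * ρ x = 1 := by rw [← map_mul, inv_mul_cancel, map_one]
    have h2 : ρ x * star (ρ x) = 1 := Matrix.mem_unitaryGroup_iff.1 (hU x)
    rw [← Matrix.star_eq_conjTranspose]
    calc ρ x⁻¹ = (ρ x)⁻¹ := (Matrix.inv_eq_left_inv h1).symm
      _ = star (ρ x) := Matrix.inv_eq_right_inv h2
  have h3 : ‖ρ g⁻¹ - ρ t⁻¹‖ = ‖ρ g - ρ t‖ := by
    rw [hstar g, hstar t, ← Matrix.conjTranspose_sub, Matrix.frobenius_norm_conjTranspose]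
  calc ‖ρ (g * W * g⁻¹) - ρ (t * W * t⁻¹)‖
      = ‖(ρ g - ρ t) * (ρ W * ρ g⁻¹) + ρ t * ρ W * (ρ g⁻¹ - ρ t⁻¹)‖ := by rw [e]
    _ ≤ ‖(ρ g - ρ t) * (ρ W * ρ g⁻¹)‖ + ‖ρ t * ρ W * (ρ g⁻¹ - ρ t⁻¹)‖ := norm_add_le _ _
    _ = 2 * ‖ρ g - ρ t‖ := by rw [h1, h2, h3]; ring

/-! ## §2 A maximal separated set is a net of controlled cardinality -/

/-- Packing bound: an `r`-separated finite subset of `G` has at most `1/Haar(B_{r/2})` points. -/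
theorem card_mul_haar_le_one_of_separated (hρ : Continuous ρ) (hU : ∀ g, ρ g ∈ Matrix.unitaryGroup (Fin N) ℂ)
    {r : ℝ} (T : Finset G) (hT : ∀ t ∈ T, ∀ t' ∈ T, t ≠ t' → r < ‖ρ t - ρ t'‖) :
    (T.card : ℝ) * (haarProbability G).real {g : G | ‖ρ g - 1‖ ≤ r / 2} ≤ 1 := by
  haveI : IsProbabilityMeasure (haarProbability G) := inferInstance
  -- the balls `B(t, r/2)`, `t ∈ T`, are pairwise disjoint and measurable
  set B : G → Set G := fun t => {g : G | ‖ρ g - ρ t‖ ≤ r / 2} with hB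
  have hBm : ∀ t, MeasurableSet (B t) := fun t => by
    rw [hB]; dsimp only; rw [setOf_norm_sub_le_eq_preimage ρ hU t]
    exact (measurableSet_gball ρ hρ _).preimage (measurable_const_mul _)
  have hdisj : Set.PairwiseDisjoint (↑T : Set G) B := by
    intro t ht t' ht' hne
    rw [Function.onFun, Set.disjoint_left]
    intro g hg hg'
    have h1 : ‖ρ g - ρ t‖ ≤ r / 2 := hg
    have h2 : ‖ρ g - ρ t'‖ ≤ r / 2 := hg'
    have h3 : ‖ρ t - ρ t'‖ ≤ r := by
      calc ‖ρ t - ρ t'‖ = ‖(ρ g - ρ t') - (ρ g - ρ t)‖ := by congr 1; abel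
        _ ≤ ‖ρ g - ρ t'‖ + ‖ρ g - ρ t‖ := norm_sub_le _ _
        _ ≤ r := by linarith
    exact absurd (hT t ht t' ht' hne) (not_lt.2 h3)
  have hsum : ∑ t ∈ T, (haarProbability G).real (B t) = (haarProbability G).real (⋃ t ∈ T, B t) :=
    (measureReal_biUnion_finset hdisj fun t _ => hBm t).symm
  have heach : ∀ t ∈ T, (haarProbability G).real (B t) = (haarProbability G).real {g : G | ‖ρ g - 1‖ ≤ r / 2} :=
    fun t _ => by rw [Measure.real, Measure.real, hB]; dsimp only; rw [haar_setOf_norm_sub_le ρ hU t]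
  calc (T.card : ℝ) * (haarProbability G).real {g : G | ‖ρ g - 1‖ ≤ r / 2}
      = ∑ t ∈ T, (haarProbability G).real (B t) := by rw [Finset.sum_congr rfl heach, Finset.sum_const, nsmul_eq_mul]
    _ = (haarProbability G).real (⋃ t ∈ T, B t) := hsum
    _ ≤ 1 := measureReal_le_one

/-- **An `r`-net of cardinality `≤ 1/Haar(B_{r/2})`**: a maximal `r`-separated finite set (it exists because separated sets have
bounded cardinality) is within `r` of every point. -/
theorem exists_net (hρ : Continuous ρ) (hU : ∀ g, ρ g ∈ Matrix.unitaryGroup (Fin N) ℂ) {r : ℝ}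
    (hpos : 0 < (haarProbability G).real {g : G | ‖ρ g - 1‖ ≤ r / 2}) :
    ∃ T : Finset G, (T.card : ℝ) * (haarProbability G).real {g : G | ‖ρ g - 1‖ ≤ r / 2} ≤ 1 ∧
      ∀ g : G, ∃ t ∈ T, ‖ρ g - ρ t‖ ≤ r := by
  classical
  set v : ℝ := (haarProbability G).real {g : G | ‖ρ g - 1‖ ≤ r / 2} with hv
  set M : ℕ := ⌊1 / v⌋₊ with hM
  let Sep : Finset G → Prop := fun T => ∀ t ∈ T, ∀ t' ∈ T, t ≠ t' → r < ‖ρ t - ρ t'‖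
  have hcard : ∀ T : Finset G, Sep T → T.card ≤ M := by
    intro T hT
    have h := card_mul_haar_le_one_of_separated ρ hρ hU T hT
    rw [hM]
    refine Nat.le_floor ?_
    rw [le_div_iff₀ hpos]
    exact h
  let P : ℕ → Prop := fun n => ∃ T : Finset G, Sep T ∧ T.card = n
  have hP0 : P 0 := ⟨∅, by simp [Sep], rfl⟩
  set m : ℕ := Nat.findGreatest P M with hm
  obtain ⟨T, hT, hTc⟩ : P m := Nat.findGreatest_spec (Nat.zero_le M) hP0
  refine ⟨T, card_mul_haar_le_one_of_separated ρ hρ hU T hT, fun g => ?_⟩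
  by_contra hfar
  push Not at hfar
  -- `insert g T` is separated and has `m + 1` points: contradiction with maximality
  have hr0 : 0 ≤ r := by
    by_contra hneg
    push Not at hneg
    have hempty : {g : G | ‖ρ g - 1‖ ≤ r / 2} = ∅ := by
      ext x
      simp only [Set.mem_setOf_eq, Set.mem_empty_iff_false, iff_false, not_le]
      exact lt_of_lt_of_le (by linarith) (norm_nonneg _)
    rw [hv, hempty, measureReal_empty] at hpos
    exact lt_irrefl _ hpos
  have hg : g ∉ T := by
    intro hgT
    have h := hfar g hgT
    rw [sub_self, norm_zero] at h
    linarith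
  have hSep' : Sep (insert g T) := by
    intro t ht t' ht' hne
    rw [Finset.mem_insert] at ht ht'
    rcases ht with ht | ht <;> rcases ht' with ht' | ht'
    · exact absurd (ht.trans ht'.symm) hne
    · rw [ht]; exact hfar t' ht'
    · rw [ht', norm_sub_rev]; exact hfar t ht
    · exact hT t ht t' ht' hne
  have hcard' : (insert g T).card = m + 1 := by rw [Finset.card_insert_of_notMem hg, hTc]
  have hle : m + 1 ≤ M := hcard' ▸ hcard _ hSep'
  have := Nat.le_findGreatest (P := P) hle ⟨insert g T, hSep', hcard'⟩
  rw [← hm] at this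
  omega

/-! ## §3 The orbit tube -/

/-- **Volume of a conjugation-orbit tube.** For a compact group `G` with a faithful unitary representation `ρ` (`D = dimE ρ`) and a
finite index type `ι` there are `C > 0` and `r₀ = 1` such that for EVERY centre `W : ι → G` and every `0 < r ≤ 1`,
`Haar^ι {V | ∃ g, ∀ e, ‖ρ(V e) − ρ(g W_e g⁻¹)‖ ≤ r} ≤ C · r^{D(|ι|−1)}` (natural-number exponent; for `|ι| = 0` the bound is the
trivial `≤ C`). -/
theorem orbitTube_measureReal_le {ι : Type*} [Fintype ι] (hρ : Continuous ρ) (hinj : Function.Injective ρ)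
    (hU : ∀ g, ρ g ∈ Matrix.unitaryGroup (Fin N) ℂ) :
    ∃ C : ℝ, 0 < C ∧ ∀ (W : ι → G) (r : ℝ), 0 < r → r ≤ 1 →
      (Measure.pi fun _ : ι => haarProbability G).real
          {V : ι → G | ∃ g : G, ∀ e, ‖ρ (V e) - ρ (g * W e * g⁻¹)‖ ≤ r} ≤
        C * r ^ (dimE ρ * (Fintype.card ι - 1)) := by
  classical
  haveI : IsProbabilityMeasure (haarProbability G) := inferInstance
  obtain ⟨c₁, hc₁, hlow⟩ := exists_haar_gball_ge ρ hρ hinj hU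
  obtain ⟨c₂, hc₂, hup⟩ := exists_haar_gball_le ρ hρ hinj hU
  set D : ℕ := dimE ρ with hD
  set F : ℕ := Fintype.card ι with hF
  -- the constant
  set C : ℝ := (2 : ℝ) ^ D / c₁ * (c₂ * 3 ^ D) ^ F + 1 with hC
  have hC0 : 0 < C := by positivity
  refine ⟨C, hC0, fun W r hr hr1 => ?_⟩
  set μ := (Measure.pi fun _ : ι => haarProbability G) with hμ
  haveI : IsProbabilityMeasure μ := by rw [hμ]; infer_instance
  -- small-ball floor at `r/2` (real form)
  have hv : c₁ * (r / 2) ^ D ≤ (haarProbability G).real {g : G | ‖ρ g - 1‖ ≤ r / 2} := by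
    have h := hlow (r / 2) (by positivity) (by linarith)
    rw [Measure.real]
    exact (ENNReal.ofReal_le_iff_le_toReal (measure_ne_top _ _)).1 h
  have hvpos : 0 < (haarProbability G).real {g : G | ‖ρ g - 1‖ ≤ r / 2} := lt_of_lt_of_le (by positivity) hv
  obtain ⟨T, hTcard, hnet⟩ := exists_net ρ hρ hU hvpos
  -- `|T| ≤ 2^D/(c₁ r^D)`
  have hT : (T.card : ℝ) ≤ (2 : ℝ) ^ D / c₁ * (r ^ D)⁻¹ := by
    have h1 : (T.card : ℝ) * (c₁ * (r / 2) ^ D) ≤ 1 :=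
      (mul_le_mul_of_nonneg_left hv (Nat.cast_nonneg _)).trans hTcard
    have hpos : 0 < c₁ * (r / 2) ^ D := by positivity
    rw [← le_div_iff₀ hpos] at h1
    refine h1.trans (le_of_eq ?_)
    rw [div_pow]; field_simp
  -- the tube is covered by the boxes around the net conjugates
  set box : G → Set (ι → G) := fun t => Set.pi Set.univ fun e => {v : G | ‖ρ v - ρ (t * W e * t⁻¹)‖ ≤ 3 * r} with hbox
  have hcover : {V : ι → G | ∃ g : G, ∀ e, ‖ρ (V e) - ρ (g * W e * g⁻¹)‖ ≤ r} ⊆ ⋃ t ∈ T, box t := by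
    rintro V ⟨g, hg⟩
    obtain ⟨t, ht, hgt⟩ := hnet g
    refine Set.mem_biUnion (Finset.mem_coe.2 ht) ?_
    rw [hbox]; simp only [Set.mem_pi, Set.mem_univ, Set.mem_setOf_eq, forall_true_left]
    intro e
    calc ‖ρ (V e) - ρ (t * W e * t⁻¹)‖
        = ‖(ρ (V e) - ρ (g * W e * g⁻¹)) + (ρ (g * W e * g⁻¹) - ρ (t * W e * t⁻¹))‖ := by congr 1; abel
      _ ≤ ‖ρ (V e) - ρ (g * W e * g⁻¹)‖ + ‖ρ (g * W e * g⁻¹) - ρ (t * W e * t⁻¹)‖ := norm_add_le _ _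
      _ ≤ r + 2 * ‖ρ g - ρ t‖ := add_le_add (hg e) (norm_conj_sub_conj_le ρ hU g t (W e))
      _ ≤ 3 * r := by linarith
  -- mass of one box
  have hbox_le : ∀ t : G, μ.real (box t) ≤ (c₂ * (3 * r) ^ D) ^ F := by
    intro t
    rw [Measure.real, hμ, hbox]; dsimp only
    rw [Measure.pi_pi]
    have heach : ∀ e : ι, haarProbability G {v : G | ‖ρ v - ρ (t * W e * t⁻¹)‖ ≤ 3 * r} ≤
        ENNReal.ofReal (c₂ * (3 * r) ^ D) := fun e => by
      rw [haar_setOf_norm_sub_le ρ hU]; exact hup (3 * r) (by positivity)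
    have hprod : (∏ e : ι, haarProbability G {v : G | ‖ρ v - ρ (t * W e * t⁻¹)‖ ≤ 3 * r}) ≤
        ∏ _e : ι, ENNReal.ofReal (c₂ * (3 * r) ^ D) := Finset.prod_le_prod' fun e _ => heach e
    rw [Finset.prod_const, Finset.card_univ] at hprod
    have hne : (ENNReal.ofReal (c₂ * (3 * r) ^ D)) ^ F ≠ ⊤ := ENNReal.pow_ne_top ENNReal.ofReal_ne_top
    calc (∏ e : ι, haarProbability G {v : G | ‖ρ v - ρ (t * W e * t⁻¹)‖ ≤ 3 * r}).toReal
        ≤ ((ENNReal.ofReal (c₂ * (3 * r) ^ D)) ^ F).toReal := ENNReal.toReal_mono hne hprod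
      _ = (c₂ * (3 * r) ^ D) ^ F := by rw [ENNReal.toReal_pow, ENNReal.toReal_ofReal (by positivity)]
  -- union bound
  have hunion : μ.real (⋃ t ∈ T, box t) ≤ ∑ t ∈ T, μ.real (box t) := measureReal_biUnion_finset_le T box
  have hmain : μ.real {V : ι → G | ∃ g : G, ∀ e, ‖ρ (V e) - ρ (g * W e * g⁻¹)‖ ≤ r} ≤
      (2 : ℝ) ^ D / c₁ * (r ^ D)⁻¹ * (c₂ * (3 * r) ^ D) ^ F := by
    calc μ.real {V : ι → G | ∃ g : G, ∀ e, ‖ρ (V e) - ρ (g * W e * g⁻¹)‖ ≤ r}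
        ≤ μ.real (⋃ t ∈ T, box t) := measureReal_mono hcover (measure_ne_top μ _)
      _ ≤ ∑ t ∈ T, μ.real (box t) := hunion
      _ ≤ ∑ _t ∈ T, (c₂ * (3 * r) ^ D) ^ F := Finset.sum_le_sum fun t _ => hbox_le t
      _ = T.card * (c₂ * (3 * r) ^ D) ^ F := by rw [Finset.sum_const, nsmul_eq_mul]
      _ ≤ (2 : ℝ) ^ D / c₁ * (r ^ D)⁻¹ * (c₂ * (3 * r) ^ D) ^ F := by gcongr
  -- arithmetic: `r^{-D} · r^{D F} = r^{D (F - 1)}` when `F ≥ 1`; trivial bound when `F = 0`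
  rcases Nat.eq_zero_or_pos F with hF0 | hFpos
  · -- `F = 0`: probability bound
    have h1 : μ.real {V : ι → G | ∃ g : G, ∀ e, ‖ρ (V e) - ρ (g * W e * g⁻¹)‖ ≤ r} ≤ 1 := measureReal_le_one
    rw [hF0, Nat.zero_sub, mul_zero, pow_zero, mul_one]
    have : (1 : ℝ) ≤ C := by
      rw [hC]; have : 0 ≤ (2 : ℝ) ^ D / c₁ * (c₂ * 3 ^ D) ^ F := by positivity
      linarith
    linarith
  · have hrD : 0 < r ^ D := pow_pos hr D
    have key : (2 : ℝ) ^ D / c₁ * (r ^ D)⁻¹ * (c₂ * (3 * r) ^ D) ^ F =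
        (2 : ℝ) ^ D / c₁ * (c₂ * 3 ^ D) ^ F * r ^ (D * (F - 1)) := by
      obtain ⟨F', hF'⟩ : ∃ F', F = F' + 1 := ⟨F - 1, by omega⟩
      rw [hF', Nat.add_sub_cancel, mul_pow (3 : ℝ) r D, ← mul_assoc c₂, mul_pow (c₂ * 3 ^ D) (r ^ D),
        pow_succ (r ^ D) F', ← pow_mul, mul_comm D F']
      field_simp
    rw [key] at hmain
    refine hmain.trans ?_
    have hrpow : 0 ≤ r ^ (D * (F - 1)) := pow_nonneg hr.le _
    have : (2 : ℝ) ^ D / c₁ * (c₂ * 3 ^ D) ^ F ≤ C := by rw [hC]; linarith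
    exact mul_le_mul_of_nonneg_right this hrpow

end Summit.QuantumFields.YangMills.Theorems.TwistExponentGap

end
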